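import Summits.KontsevichZagierPeriods.KontsevichZagierPeriods.Theses.EulerFormChain
import Summits.KontsevichZagierPeriods.KontsevichZagierPeriods.Theorems.InverseLandauTateLiftingInversionChart
import Summits.KontsevichZagierPeriods.KontsevichZagierPeriods.Theorems.InverseLandauTateLiftingArcsinBandValue
import Summits.KontsevichZagierPeriods.KontsevichZagierPeriods.Theorems.InverseLandauTateLiftingSLTwoZCovolume

/-!
# `SLTwoZCovolume` (stmt-KontsevichZagierPeriods-12917, route EulerFormChain) — proof

THE COVOLUME OF THE MODULAR GROUP INSIDE THE KONTSEVICH–ZAGIER RULES: the standard fundamental domain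
`F₁ = {|x| ≤ ½, x² + y² ≥ 1, y > 0}` of `SL₂(ℤ)` with the hyperbolic area form `dx dy/y²` (value `π/3`) is KZ-equivalent to
`[D̄, 1/3]`. Proof: stubs 66–68 of line `Sketch` of crux `TateLifting` — the inversion engine `t = 1/y` (one rule-(2) move,
`tateLifting_inversionChart`), the area `2 arcsin ½ = π/3` of the resulting bounded conic band (`tateLifting_arcsinBandValue`), and the
landed conic-band kernel with torsion-freeness of `FormalRep ⧸ relations` (`tateLifting_slTwoZCovolume`).
-/

namespace Summit.KontsevichZagierPeriods.EulerFormChain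

/-- **`SLTwoZCovolume`** (route EulerFormChain, stmt-KontsevichZagierPeriods-12917): `[F₁, y⁻²] ∼ [D̄, 1/3]`.
Proof: `InverseLandau.tateLifting_slTwoZCovolume` applied to the inversion engine and the arcsine-band area.
[cite: KontsevichZagier2001, §1.2] -/
theorem slTwoZCovolume_proof :
    Summit.KontsevichZagierPeriods.KontsevichZagierPeriods.Theses.EulerFormChain.SLTwoZCovolume :=
  Summit.KontsevichZagierPeriods.InverseLandau.tateLifting_slTwoZCovolume
    Summit.KontsevichZagierPeriods.InverseLandau.tateLifting_inversionChart
    Summit.KontsevichZagierPeriods.InverseLandau.tateLifting_arcsinBandValue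

end Summit.KontsevichZagierPeriods.EulerFormChain
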